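import Summits.BirchSwinnertonDyer.Rank1Residual.Partition.MainConjecturesEisensteinAtPrime
import Summits.BirchSwinnertonDyer.Rank1Residual.Partition.MazurMainConjectureAtThreeOPEN
import HarnessLib

/-!
# Row D4 at `p = 3`: Castella–Grossi–Skinner's Theorem D @3 from the cell's ONE displayed open binder
# (`RowC6.CastellaGrossiSkinner2025_thmA_atThree_OPEN`), `K`-free

HONEST FRAMING (cell `bsd-litref`, programme §T2d, verbatim): "no tranche here proves BSD". THEOREMS
ONLY; CONDITIONAL on the typed @3 binder (the in-cell referee's GAP(line): CGS25 Thm. 4.1.1 ⇐ BSTW §5 ⇐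
KLZ17 «p ≥ 5» / [SV-S-Ohta] unposted — sheet `cgs25/sheets/D-AUDIT-cgs25-r1.md` §0, §5.4), which is
NOT a theorem; nothing is booked. Seat `bsd-litref-cgs25-pv` (prover), the corollary agreed with the
typer (`cgs25/INBOX.md` 18:29Z: «your HL-based K-free corollary is the better census closer; land it …
when p461118 is accepted»).

* `RowC6.bsdp_three_of_thmA_atThree_OPEN` — for every `W/ℚ` globally minimal elliptic with `3` good,
  `E[3]` reducible, `a_3 ≢ 1 (mod 3)` and `ord_{s=1}L(E,s) ≤ 1`: the @3 binder ⟹ `BSDp W 3`, by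
  `RowC6.bsdp_of_display55_of_mazurMainConjectureAt (p := 3)` (p459542) fed with the binder read at
  `p = 3` in analytic rank `0` (the binder's body IS `MazurMainConjecture V 3`, defeq) — together with
  the PUBLISHED A157 (5.5), Greenberg Thm. 4.1, Hoffstein–Luo, Gross–Zagier (both currencies),
  Kolyvagin, GZK, modularity. No auxiliary field, no twist model, no certificate among the binders:
  the census applies it to the 1 783 @3 classes of row D4 (1 638 r = 1, 145 r = 0) as ONE conditional
  road, next to the per-class UNconditional roads (twist certificate, 1 635 r1@3 keys two-engine:
  `…TwistCertificate[Keys]`; Wuthrich / Schneider certificates: `EisensteinGoodComplementSplit`).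

References: [CastellaGrossiSkinner2025] Thm. D, Theorem A = Thm. 7.1.1, Thm. 4.1.1; the typer's file
`Partition/MazurMainConjectureAtThreeOPEN.lean` (p461118); `Partition/MainConjecturesEisensteinAtPrime.lean`
(p459542).
-/

set_option autoImplicit false

noncomputable section

open scoped Classical

open WeierstrassCurve NumberField Literature.NumberTheory.EllipticCurves
  Literature.NumberTheory.EllipticCurves.ModularForms Literature.NumberTheory.QuadraticFields
  Literature.NumberTheory.EllipticCurves.Rank1Residual
  Literature.NumberTheory.EllipticCurves.CastellaGrossiLeeSkinner2022
  Summit.BirchSwinnertonDyer.BirchSwinnertonDyer.Theorems.Rank1ResidualX1Defs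

namespace Summit.BirchSwinnertonDyer.Rank1Residual

/-- **CGS25 Theorem D at `p = 3` on row C6, from the ONE open @3 binder, `K`-free.** For `W/ℚ`
globally minimal elliptic with `3` good, `E[3]` reducible, `a_3 ≢ 1 (mod 3)` and `ord_{s=1}L(E,s) ≤ 1`:
granted `RowC6.CastellaGrossiSkinner2025_thmA_atThree_OPEN` (`hA3`, the typed GAP binder — NOT a
theorem) and the published facts A157 (5.5) (`h55`), Greenberg Thm. 4.1 (`hGr`), modularity (`hmodP`,
`hnf`), Hoffstein–Luo (`hHL`), Gross–Zagier (`hGZQ`, `hGZ`), Kolyvagin (`hKo`), GZK (`hGZK`): `BSDp W 3`.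
One line over `RowC6.bsdp_of_display55_of_mazurMainConjectureAt` at `p = 3` (the binder's conclusion is
`MazurMainConjecture V 3` by `rfl`). CONDITIONAL; closes nothing by itself.
[claim: BurungaleSkinnerTianWan2024, status: under-review]
[cite: CastellaGrossiSkinner2025, Thm. D and its proof (§1.2), Theorem A = Thm. 7.1.1 at p = 3] -/
theorem RowC6.bsdp_three_of_thmA_atThree_OPEN (hA3 : RowC6.CastellaGrossiSkinner2025_thmA_atThree_OPEN)
    (h55 : display55_sha_heegnerIndex) (hGr : greenberg_charValue_rankZero)
    (hmodP : nonempty_modularParametrizationData) (hnf : exists_isNewformOf)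
    (hHL : HoffsteinLuo1997_exists_twist_L_one_ne_zero) (hGZQ : GrossZagier1986_thm_I_7_3)
    (hGZ : ∀ (N : ℕ) [NeZero N] (W : WeierstrassCurve ℚ) (K : Type) [Field K] [NumberField K],
      gross_zagier N W K)
    (hKo : ∀ (N : ℕ) [NeZero N] (W : WeierstrassCurve ℚ) (K : Type) [Field K] [NumberField K],
      kolyvagin N W K)
    (hGZK : rank_eq_analyticRank_of_analyticRank_le_one)
    (W : WeierstrassCurve ℚ) [W.IsElliptic] [W.IsGloballyMinimal] [Fact (Nat.Prime 3)]
    (hgood : Good W 3) (hred : Red W 3) (hna : ¬ Anom W 3) (hr : W.analyticRank ≤ 1) : BSDp W 3 :=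
  RowC6.bsdp_of_display55_of_mazurMainConjectureAt h55 hGr hmodP hnf hHL hGZQ hGZ hKo hGZK 3 (by norm_num)
    (fun V _ _ hg hrd hn _ ↦ hA3 V 3 rfl hg hrd hn) W hgood hred hna hr

end Summit.BirchSwinnertonDyer.Rank1Residual

end
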